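import Literature.AnabelianGeometry.EtaleTheta.ThetaSubquotientOfTemperedAutImage
import Literature.AnabelianGeometry.EtaleTheta.Discharge.Sec5ThetaSubquotientLevelNOfConnectedTemperoid

/-!
# [EtTh] Prop. 5.5 at the genuine §5 data over `B^temp(Π^tp_X)⁰`: the binders `hpre`, `hlift`, `hgeom` UNCONDITIONAL for print's image carrier at level `N`

Mochizuki, *The étale theta function and its Frobenioid-theoretic manifestations*, Publ. RIMS **45** (2009), Prop. 5.5 pp. 327–328 (PDF pp. 101–102);
§5 p. 330–331 (PDF pp. 104–105).  [cite: MochizukiEtTh2009, Prop 5.5 p.327–328 (PDF pp.101–102)]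

PROOF-ONLY (no definitions).  abc-iut cell, seat abc-iut-w4-d042 (gen 3) — the «O2 glue» asked by abc-iut-L2-lead (08:30:11Z): abc-iut-w5-d020's
`thetaSubquotientProjOfConnectedTemperoidDataAutImage` (p432202, offer O2: a TERM of abc-iut-L2-t4's `ThetaSubquotientProj` for the genuine §5 data
`ofConnectedTemperoidData h (autImageStub q ι) …` — print's IMAGE carrier, onto at every object) taken at the LEVEL-`N` parameters
`q := RD.qN ιX`, `ι := RD.iotaN` of `ThetaSubquotientLevelN.lean` (p430659, offer O1: read off abc-iut-L2-t2's `RigidData`; `Λ := μ_N`), over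
abc-iut-L2-t4's §5 choice `A_⊙^bs := Ÿ` (`mkOfConnectedTemperoidYdd X tf hZ hP NH RD.toThetaEnvData ιX`).  For THIS `P` — no equation, no hypothesis on
`P` — the binders of `cyclotomicRigidity_ofConnectedTemperoidData_of_pullRoot` (p430047) that concern `(P, ρ)`, `ρ = rhoOfBiKummerData R ιX`, are
THEOREMS, by the genuine-`ρ` laws of `Discharge/Sec5ThetaSubquotientLevelNOfConnectedTemperoid.lean` (p431034) read through w5-d020's
`mem_pre_…_iff` (`Iff.rfl`):

* `hpre_autImage_levelN` — `k ∈ Π^tp_Ÿ ∩ (l·Δ_Θ) ⇒ ρ k ∈ P.pre B_N^bs`;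
* `hlift_autImage_levelN` — `a ∈ H_{B_N} = ρ(Π^tp_Ÿ)`, `a ∈ P.pre ⇒ ∃ k ∈ Π^tp_Ÿ ∩ (l·Δ_Θ)`, `ρ k = a` (NO residual subgroup hypothesis);
* `hgeom_autImage_levelN` — `P.pre B_N^bs ≤ ρ(Ker(Π^tp_X ↠ G_K))`;
* `proj_rho_coe_evalAt_eq_thetaMod_inv` — the point evaluation behind `hPproj`: `P.proj (ρ k)`, read in abc-iut-L2-t9's carrier and evaluated at the base
  point `x = (s^⊓_N)^bs(x_{A_N})`, is the class of `(thetaMod k)⁻¹ ∈ μ_N` (`evalAt_autProj_rho_eq_thetaMod_inv`, p431034).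

Universe specialisation (no hypothesis): `V : FrdIMonoidStub.{max u₀ w'}`, `RD : RigidData.{max u₀ w'}` (w5-d020's `Λ : Type w` with `w := max u₀ w'`).  The
instance `[RD.iotaN.range.Normal]` is `RigidData.iotaN_range_normal` (`haveI`).  Not restated here: `hproj` (for the image stub the transport is w5-d020's
`autImageMap`; the conjugation law is `ThetaSubquotient.map_autProj_eq_autProj_conj`, p429126) and the `lDeltaModN`-valued coefficient map `e` of `hPproj`.
Nothing of [EtTh]'s curves is asserted; no side taken on [IUTchIII] Cor. 3.12.
-/

noncomputable section

namespace Literature.AnabelianGeometry.EtaleTheta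

namespace ThetaFrobenioid

open CategoryTheory Opposite FrobenioidCyclotomicRigidity Literature.AlgebraicGeometry.Frobenioids
  Literature.AnabelianGeometry.SemiGraphs Literature.AnabelianGeometry.SemiGraphs.GaloisObjects
open Literature.AlgebraicGeometry.Frobenioids.QuasiTemperoid (stabilizerSubgroup)

universe u₀ v₀ w'

section AutImageLevelN

variable {K : Type u₀} [Field K] {X : SemiGraphs.TemperedArithmeticGroup.{u₀} K} {D₀ : Type u₀} [Category.{v₀} D₀]
  {V : FrdIMonoidStub.{max u₀ w'}} {T₀ : RealifiedDivisorMonoids (D₀ := D₀) V}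
  {VD : FrdICatStub.{u₀ + 1, u₀, max u₀ w'} (ConnectedPart (BTemp X.Pi))}
  {tf : TemperedFrobenioid T₀ (ConnectedPart (BTemp X.Pi)) VD} {hZ : tf.monoidType = MonoidType.Z}
  {hP : ∀ A : (ConnectedPart (BTemp X.Pi))ᵒᵖ, IsPerfect (tf.Φ.carrier A)}
  {NH : Subgroup (Field.absoluteGaloisGroup K) → tf.category → ℕ+ → Prop}
  {lv N : ℕ+} {l' : ℕ} {RD : RigidData.{max u₀ w'} N l'} {ιX : RD.PiX ≃ₜ* X.Pi}
  {pullFrac : ∀ {A A' : (BiKummerSetting.mkOfConnectedTemperoidYdd X tf hZ hP NH RD.toThetaEnvData ιX).C} (_ : A' ⟶ A),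
    (BiKummerSetting.mkOfConnectedTemperoidYdd X tf hZ hP NH RD.toThetaEnvData ιX).biratUnits A →
      (BiKummerSetting.mkOfConnectedTemperoidYdd X tf hZ hP NH RD.toThetaEnvData ιX).biratUnits A'}
  {θ : (BiKummerSetting.mkOfConnectedTemperoidYdd X tf hZ hP NH RD.toThetaEnvData ιX).biratUnits
    (BiKummerSetting.mkOfConnectedTemperoidYdd X tf hZ hP NH RD.toThetaEnvData ιX).Aodot}
  {Bl : (BiKummerSetting.mkOfConnectedTemperoidYdd X tf hZ hP NH RD.toThetaEnvData ιX).C}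
  {Pl : (BiKummerSetting.mkOfConnectedTemperoidYdd X tf hZ hP NH RD.toThetaEnvData ιX).FractionPair θ Bl}
  {Rl : (BiKummerSetting.mkOfConnectedTemperoidYdd X tf hZ hP NH RD.toThetaEnvData ιX).NthRoot θ Pl lv pullFrac}
  [RD.iotaN.range.Normal]
  (h : ModelFrobenioid.Hypotheses tf.divisorMonoid tf.ratFnFunctor) (odd_l : Odd (lv : ℕ))
  (R : (BiKummerSetting.mkOfConnectedTemperoidYdd X tf hZ hP NH RD.toThetaEnvData ιX).NthRoot Rl.root Rl.pair N pullFrac)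
  (K' : Type (max u₀ w')) [Field K'] (constEmb : K'ˣ →* tf.biratUnitsModel R.BN) (constEmb_injective : Function.Injective constEmb)
  (hinvc : ∀ g : Aut R.AN.base,
    pull tf.divisorMonoid g.hom (ModelFrobenioid.div R.pair.num) = ModelFrobenioid.div R.pair.num)
  (hinvp : ∀ y : RD.PiX, y ∈ RD.PiYdd →
    pull tf.divisorMonoid ((BiKummerSetting.mkOfConnectedTemperoidYdd X tf hZ hP NH RD.toThetaEnvData ιX).galoisSurj R.AN.base
      R.αData.isGalois (ιX y)).hom (ModelFrobenioid.div R.pair.den) = ModelFrobenioid.div R.pair.den)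

/-- **hpre UNCONDITIONAL** at print's image carrier (level `N`): `k ∈ Π^tp_Ÿ ∩ (l·Δ_Θ) ⇒ ρ k ∈ P.pre B_N^bs`.
[cite: MochizukiEtTh2009, Prop 5.5 p.327 (PDF p.101)] -/
theorem hpre_autImage_levelN : ∀ k : RD.PiYdd, (k : RD.PiX) ∈ RD.lDeltaTheta →
    rhoOfBiKummerData R ιX k ∈
      (thetaSubquotientProjOfConnectedTemperoidDataAutImage h (RD.qN ιX) RD.iotaN odd_l R ιX K' constEmb constEmb_injective
        hinvc hinvp).pre R.BN.base :=
  fun k hk => mapAut_rho_mem_autPre_of_coe_mem_lDeltaTheta R ιX k hk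

/-- **hlift UNCONDITIONAL** (`A_⊙^bs := Ÿ`): an element of `H_{B_N} = ρ(Π^tp_Ÿ)` in `P.pre B_N^bs` lifts to `Π^tp_Ÿ ∩ (l·Δ_Θ)`.
[cite: MochizukiEtTh2009, Prop 5.5 proof p.327–328 (PDF pp.101–102)] -/
theorem hlift_autImage_levelN :
    ∀ a ∈ (ofConnectedTemperoidData h (ThetaSubquotient.autImageStub (RD.qN ιX) RD.iotaN) odd_l R ιX K' constEmb constEmb_injective
        hinvc hinvp).HB,
      a ∈ (thetaSubquotientProjOfConnectedTemperoidDataAutImage h (RD.qN ιX) RD.iotaN odd_l R ιX K' constEmb constEmb_injective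
          hinvc hinvp).pre R.BN.base →
        ∃ k : RD.PiYdd, (k : RD.PiX) ∈ RD.lDeltaTheta ∧ rhoOfBiKummerData R ιX k = a := by
  intro a ha hm
  change a ∈ RD.PiYdd.map (rhoOfBiKummerData R ιX) at ha
  obtain ⟨k₀, hk₀, rfl⟩ := ha
  exact exists_lift_rho_PiYdd_lDeltaTheta R ⟨k₀, hk₀⟩ hm

/-- **hgeom UNCONDITIONAL**: `P.pre B_N^bs ≤ ρ(Ker(Π^tp_X ↠ G_K))`. [cite: MochizukiEtTh2009, §2 p.45; Prop 5.5 p.327 (PDF p.101)] -/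
theorem hgeom_autImage_levelN :
    (thetaSubquotientProjOfConnectedTemperoidDataAutImage h (RD.qN ιX) RD.iotaN odd_l R ιX K' constEmb constEmb_injective
        hinvc hinvp).pre R.BN.base ≤ RD.aug.ker.map (rhoOfBiKummerData R ιX) := by
  intro g hg
  obtain ⟨k, hk, hρ⟩ := exists_mem_lDeltaTheta_mapAut_rho_eq_of_mem_autPre R ιX hg
  exact ⟨k, (RD.lDeltaTheta_le hk).2, Iso.ext (ObjectProperty.hom_ext _ (congrArg Iso.hom hρ))⟩

/-- **The point evaluation behind hPproj, UNCONDITIONAL**: for `k ∈ Π^tp_Ÿ ∩ (l·Δ_Θ)`, `P.proj (ρ k)` read in abc-iut-L2-t9's carrier (w5-d020's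
`_proj_coe`) evaluates at the base point `x = (s^⊓_N)^bs(x_{A_N})` to the class of `(thetaMod k)⁻¹ ∈ μ_N`.  [cite: MochizukiEtTh2009, §5 p.327 (PDF p.101); §2 p.46] -/
theorem proj_rho_coe_evalAt_eq_thetaMod_inv (k : RD.PiYdd) (hk : (k : RD.PiX) ∈ RD.lDeltaTheta)
    (hm : rhoOfBiKummerData R ιX k ∈
      (thetaSubquotientProjOfConnectedTemperoidDataAutImage h (RD.qN ιX) RD.iotaN odd_l R ιX K' constEmb constEmb_injective
        hinvc hinvp).pre R.BN.base) :
    ThetaSubquotient.evalAt (RD.qN ιX) RD.iotaN R.BN.base.obj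
        ((BiKummerSetting.NthRoot.baseIso _ R).hom.hom.hom.hom (galoisBase X.isTempered R.AN.base.obj R.αData.isGalois))
        (Subtype.val ((thetaSubquotientProjOfConnectedTemperoidDataAutImage h (RD.qN ιX) RD.iotaN odd_l R ιX K' constEmb
          constEmb_injective hinvc hinvp).proj R.BN.base ⟨_, hm⟩)) =
      QuotientGroup.mk (RD.thetaMod ⟨k, hk⟩)⁻¹ :=
  evalAt_autProj_rho_eq_thetaMod_inv R ιX (k : RD.PiX) hk hm

end AutImageLevelN

end ThetaFrobenioid

end Literature.AnabelianGeometry.EtaleTheta
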